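import Summits.PneNP.PneNP.Theorems.ReslinSizeFromWidthQuadraticCylinders

/-!
# PneNP / ReslinSizeFromWidth — quadratic size–width law, part 2a: semantic refutations

Helper file for the quadratic truncation of crux `ResLinSizeFromWidth` (stmt-PneNP-18932).
A SEMANTIC Res(⊕) REFUTATION inside an ambient flat `A ⊆ 𝔽₂^V` of a set `𝒞` of axiom flats (the
falsifying sets of the clauses) is a list of flats `N ⊆ A` — head = last line — each justified by
the lines after it: an AXIOM step (`N ⊆ F`, `F ∈ 𝒞`) or a SPLIT step (the halves `N ∩ hyp θ`,
`N ∩ hyp (θ+1)` lie in two earlier lines; a semantic weakening is the split by the inconsistent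
equation); it refutes if `A` itself is a line.  This is the falsifying-set view of Itsykson–Sokolov
Res(⊕) with semantic weakening (a resolution step `C ∨ (f=0), D ∨ (f=1) ⊢ C ∨ D` splits
`fals (C ∨ D)` along `f`), relativised to `A` so that affine restrictions become intersections with
hyperplanes.  The RANK of a line relative to `A` is `dim W N - dim W A`; the WIDTH of a refutation
is the maximal rank of a nonempty line.  Contents: definitions, monotonicity, filtering, and the
RESTRICTION to a sub-flat (sizes do not grow; ranks do not grow under hyperplane sections).
-/

namespace Summit.PneNP.PneNP.Theorems

-- `Summit.PneNP.PneNP` repeats a path component by design (summit = sub-problem); silence the linter.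
set_option linter.dupNamespace false

namespace ResLinSW

section Semantic

open Module Submodule
open scoped Pointwise

variable {V : Type*} [Fintype V]

/-! ### Semantic refutations -/

/-- `N` is JUSTIFIED by the earlier lines `prev` over the axiom flats `𝒞`: an axiom step, or a
split of `N` by an equation `θ` into two halves contained in earlier lines. -/
inductive Justified (𝒞 : Set (Set (V → ZMod 2))) (prev : List (Set (V → ZMod 2)))
    (N : Set (V → ZMod 2)) : Prop
  /-- axiom step: `N` lies inside an axiom flat -/
  | ax (F : Set (V → ZMod 2)) (hF : F ∈ 𝒞) (h : N ⊆ F) : Justified 𝒞 prev N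
  /-- split step: the two halves of `N` along `θ` lie in earlier lines `P`, `Q` -/
  | split (θ : Eqn V) (P Q : Set (V → ZMod 2)) (hP : P ∈ prev) (hQ : Q ∈ prev)
      (h0 : N ∩ hyp θ ⊆ P) (h1 : N ∩ hyp (θ + one) ⊆ Q) : Justified 𝒞 prev N

/-- A semantic DERIVATION (head = last line): every line is justified by the lines after it. -/
def IsDeriv (𝒞 : Set (Set (V → ZMod 2))) : List (Set (V → ZMod 2)) → Prop
  | [] => True
  | N :: L => Justified 𝒞 L N ∧ IsDeriv 𝒞 L

/-- A semantic REFUTATION inside the ambient flat `A`: a derivation all of whose lines are flats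
contained in `A`, one of which is `A` itself. -/
structure IsRef (𝒞 : Set (Set (V → ZMod 2))) (A : Set (V → ZMod 2))
    (L : List (Set (V → ZMod 2))) : Prop where
  /-- every line is justified by later-listed (earlier-derived) lines -/
  deriv : IsDeriv 𝒞 L
  /-- the ambient flat is derived -/
  root : A ∈ L
  /-- all lines live inside the ambient flat -/
  subset : ∀ N ∈ L, N ⊆ A
  /-- all lines are flats -/
  flat : ∀ N ∈ L, IsFlat N

/-- The RANK of a flat `N ⊆ A` relative to `A`: `dim W N - dim W A` (its codimension in `A`). -/
noncomputable def codim (A N : Set (V → ZMod 2)) : ℕ :=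
  finrank (ZMod 2) ↥(W N) - finrank (ZMod 2) ↥(W A)

open Classical in
/-- The rank of a line, empty lines counting `0`. -/
noncomputable def lineRank (A N : Set (V → ZMod 2)) : ℕ :=
  if N.Nonempty then codim A N else 0

/-- The WIDTH of a list of lines relative to `A`: the maximal rank of a nonempty line. -/
noncomputable def width (A : Set (V → ZMod 2)) (L : List (Set (V → ZMod 2))) : ℕ :=
  (L.map (lineRank A)).foldr max 0

omit [Fintype V] in
/-- `l.foldr max 0 ≤ n` iff every entry is `≤ n` (helper). -/
theorem foldr_max_le_iff (l : List ℕ) (n : ℕ) : l.foldr max 0 ≤ n ↔ ∀ x ∈ l, x ≤ n := by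
  induction l with
  | nil => simp
  | cons a l ih => simp [ih]

/-- The width is `≤ w` iff every nonempty line has rank `≤ w`. -/
theorem width_le_iff {A : Set (V → ZMod 2)} {L : List (Set (V → ZMod 2))} {w : ℕ} :
    width A L ≤ w ↔ ∀ N ∈ L, N.Nonempty → codim A N ≤ w := by
  classical
  rw [width, foldr_max_le_iff]
  simp only [List.mem_map, forall_exists_index, and_imp, forall_apply_eq_imp_iff₂, lineRank]
  constructor
  · intro h N hN hne
    have := h N hN
    rwa [if_pos hne] at this
  · intro h N hN
    split_ifs with hne
    · exact h N hN hne
    · exact Nat.zero_le _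

/-- A nonempty line's rank is at most the width. -/
theorem codim_le_width {A : Set (V → ZMod 2)} {L : List (Set (V → ZMod 2))} {N : Set (V → ZMod 2)}
    (hN : N ∈ L) (hne : N.Nonempty) : codim A N ≤ width A L :=
  (width_le_iff.1 le_rfl) N hN hne

/-- If the width is `≥ K` (and `K ≥ 1`) some nonempty line has rank `≥ K`. -/
theorem exists_codim_ge_of_le_width {A : Set (V → ZMod 2)} {L : List (Set (V → ZMod 2))} {K : ℕ}
    (hK : 1 ≤ K) (h : K ≤ width A L) : ∃ N ∈ L, N.Nonempty ∧ K ≤ codim A N := by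
  by_contra hcon
  push Not at hcon
  have : width A L ≤ K - 1 := width_le_iff.2 fun N hN hne => by
    have := hcon N hN hne
    omega
  omega

/-! ### Basic manipulations of derivations -/

/-- Justification is monotone in the stock of earlier lines. -/
theorem Justified.mono {𝒞 : Set (Set (V → ZMod 2))} {prev prev' : List (Set (V → ZMod 2))}
    {N : Set (V → ZMod 2)} (h : Justified 𝒞 prev N) (hsub : ∀ P ∈ prev, P ∈ prev') :
    Justified 𝒞 prev' N := by
  cases h with
  | ax F hF h => exact Justified.ax F hF h
  | split θ P Q hP hQ h0 h1 => exact Justified.split θ P Q (hsub P hP) (hsub Q hQ) h0 h1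

/-- A weakening step: `N ⊆ Q` with `Q` earlier (the split by the inconsistent equation). -/
theorem Justified.weaken {𝒞 : Set (Set (V → ZMod 2))} {prev : List (Set (V → ZMod 2))}
    {N Q : Set (V → ZMod 2)} (hQ : Q ∈ prev) (h : N ⊆ Q) : Justified 𝒞 prev N := by
  refine Justified.split one Q Q hQ hQ ?_ ?_
  · intro z hz
    rw [hyp_one] at hz
    exact absurd hz.2 (Set.notMem_empty z)
  · intro z hz
    exact h hz.1

/-- Unfolding a derivation with a head. -/
theorem isDeriv_cons {𝒞 : Set (Set (V → ZMod 2))} {N : Set (V → ZMod 2)}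
    {L : List (Set (V → ZMod 2))} : IsDeriv 𝒞 (N :: L) ↔ Justified 𝒞 L N ∧ IsDeriv 𝒞 L :=
  Iff.rfl

/-- Every suffix of a derivation starting at a line justifies that line. -/
theorem IsDeriv.justified_of_suffix {𝒞 : Set (Set (V → ZMod 2))} {L : List (Set (V → ZMod 2))}
    (hL : IsDeriv 𝒞 L) {N : Set (V → ZMod 2)} {T : List (Set (V → ZMod 2))}
    (hs : N :: T <:+ L) : Justified 𝒞 T N := by
  induction L with
  | nil =>
    obtain ⟨t, ht⟩ := hs
    simp at ht
  | cons M L ih =>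
    rcases List.suffix_cons_iff.1 hs with h | h
    · have h' := List.cons.inj h
      obtain ⟨rfl, rfl⟩ := h'
      exact hL.1
    · exact ih hL.2 h

/-- FILTERING a derivation: if every kept line is justified by the kept part of its tail, the
filtered list is a derivation. -/
theorem IsDeriv.filter {𝒞 : Set (Set (V → ZMod 2))} {L : List (Set (V → ZMod 2))}
    (hL : IsDeriv 𝒞 L) (p : Set (V → ZMod 2) → Bool)
    (hp : ∀ N T, N :: T <:+ L → p N = true → Justified 𝒞 (T.filter p) N) :
    IsDeriv 𝒞 (L.filter p) := by
  induction L with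
  | nil => simp [IsDeriv]
  | cons M L ih =>
    have ih' := ih hL.2 (fun N T hs hN => hp N T (hs.trans (List.suffix_cons M L)) hN)
    rw [List.filter_cons]
    split_ifs with hM
    · exact ⟨hp M L (List.suffix_refl _) hM, ih'⟩
    · exact ih'

/-- MAPPING a derivation through intersection with a fixed set. -/
theorem IsDeriv.map_inter {𝒞 : Set (Set (V → ZMod 2))} {L : List (Set (V → ZMod 2))}
    (hL : IsDeriv 𝒞 L) (H : Set (V → ZMod 2)) : IsDeriv 𝒞 (L.map (· ∩ H)) := by
  induction L with
  | nil => simp [IsDeriv]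
  | cons M L ih =>
    refine ⟨?_, ih hL.2⟩
    cases hL.1 with
    | ax F hF h => exact Justified.ax F hF (Set.inter_subset_left.trans h)
    | split θ P Q hP hQ h0 h1 =>
      refine Justified.split θ (P ∩ H) (Q ∩ H) (List.mem_map.2 ⟨P, hP, rfl⟩)
        (List.mem_map.2 ⟨Q, hQ, rfl⟩) ?_ ?_
      · intro z hz
        exact ⟨h0 ⟨hz.1.1, hz.2⟩, hz.1.2⟩
      · intro z hz
        exact ⟨h1 ⟨hz.1.1, hz.2⟩, hz.1.2⟩

/-- A nonempty line justified by `prev` is justified by the NONEMPTY lines of `prev`. -/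
theorem Justified.filter_nonempty {𝒞 : Set (Set (V → ZMod 2))} {prev : List (Set (V → ZMod 2))}
    {N : Set (V → ZMod 2)} (h : Justified 𝒞 prev N) (hne : N.Nonempty)
    (p : Set (V → ZMod 2) → Bool) (hp : ∀ P, p P = true ↔ P.Nonempty) :
    Justified 𝒞 (prev.filter p) N := by
  cases h with
  | ax F hF h => exact Justified.ax F hF h
  | split θ P Q hP hQ h0 h1 =>
    by_cases hPne : P.Nonempty
    · by_cases hQne : Q.Nonempty
      · exact Justified.split θ P Q (List.mem_filter.2 ⟨hP, (hp P).2 hPne⟩)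
          (List.mem_filter.2 ⟨hQ, (hp Q).2 hQne⟩) h0 h1
      · -- Q = ∅: N ⊆ hyp θ, so N ⊆ P
        rw [Set.not_nonempty_iff_eq_empty] at hQne
        have hNP : N ⊆ P := by
          intro z hz
          by_cases hzθ : z ∈ hyp θ
          · exact h0 ⟨hz, hzθ⟩
          · have := h1 ⟨hz, mem_hyp_add_one_iff.2 hzθ⟩
            rw [hQne] at this
            exact absurd this (Set.notMem_empty z)
        exact Justified.weaken (List.mem_filter.2 ⟨hP, (hp P).2 hPne⟩) hNP
    · -- P = ∅: N ⊆ hyp (θ + 1), so N ⊆ Q, and Q is nonempty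
      rw [Set.not_nonempty_iff_eq_empty] at hPne
      have hNQ : N ⊆ Q := by
        intro z hz
        by_cases hzθ : z ∈ hyp θ
        · have := h0 ⟨hz, hzθ⟩
          rw [hPne] at this
          exact absurd this (Set.notMem_empty z)
        · exact h1 ⟨hz, mem_hyp_add_one_iff.2 hzθ⟩
      have hQne : Q.Nonempty := Set.Nonempty.mono hNQ hne
      exact Justified.weaken (List.mem_filter.2 ⟨hQ, (hp Q).2 hQne⟩) hNQ

/-! ### Restriction to a sub-flat -/

open Classical in
/-- The Boolean test "nonempty". -/
noncomputable def neB (N : Set (V → ZMod 2)) : Bool := decide N.Nonempty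

omit [Fintype V] in
/-- `neB N = true ↔ N.Nonempty`. -/
theorem neB_iff (N : Set (V → ZMod 2)) : neB N = true ↔ N.Nonempty := by
  simp [neB]

/-- The RESTRICTION of a list of lines to `H`: intersect and drop the empty lines. -/
noncomputable def restrict (H : Set (V → ZMod 2)) (L : List (Set (V → ZMod 2))) :
    List (Set (V → ZMod 2)) :=
  (L.map (· ∩ H)).filter neB

/-- The restriction of a refutation inside `A` to a nonempty flat `H ⊆ A` is a refutation inside
`H`. -/
theorem isRef_restrict {𝒞 : Set (Set (V → ZMod 2))} {A : Set (V → ZMod 2)}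
    {L : List (Set (V → ZMod 2))} (hL : IsRef 𝒞 A L) {H : Set (V → ZMod 2)} (hH : IsFlat H)
    (hHA : H ⊆ A) (hHne : H.Nonempty) : IsRef 𝒞 H (restrict H L) := by
  have hmap : IsDeriv 𝒞 (L.map (· ∩ H)) := IsDeriv.map_inter hL.deriv H
  refine ⟨?_, ?_, ?_, ?_⟩
  · refine IsDeriv.filter hmap neB fun N T hs hN => ?_
    have hj := IsDeriv.justified_of_suffix hmap hs
    exact Justified.filter_nonempty hj ((neB_iff N).1 hN) neB neB_iff
  · rw [ResLinSW.restrict, List.mem_filter]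
    refine ⟨List.mem_map.2 ⟨A, hL.root, Set.inter_eq_right.2 hHA⟩, (neB_iff H).2 hHne⟩
  · intro N hN
    rw [ResLinSW.restrict, List.mem_filter, List.mem_map] at hN
    obtain ⟨⟨M, -, rfl⟩, -⟩ := hN
    exact Set.inter_subset_right
  · intro N hN
    rw [ResLinSW.restrict, List.mem_filter, List.mem_map] at hN
    obtain ⟨⟨M, hM, rfl⟩, -⟩ := hN
    exact (hL.flat M hM).inter hH

omit [Fintype V] in
/-- Lines of the restriction come from lines of the original list. -/
theorem mem_restrict_iff {H : Set (V → ZMod 2)} {L : List (Set (V → ZMod 2))}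
    {N : Set (V → ZMod 2)} : N ∈ restrict H L ↔ ∃ M ∈ L, M ∩ H = N ∧ N.Nonempty := by
  rw [restrict, List.mem_filter, List.mem_map, neB_iff]
  constructor
  · rintro ⟨⟨M, hM, rfl⟩, hne⟩
    exact ⟨M, hM, rfl, hne⟩
  · rintro ⟨M, hM, rfl, hne⟩
    exact ⟨⟨M, hM, rfl⟩, hne⟩

omit [Fintype V] in
/-- SIZE of the restriction: the original length minus the number of lines killed by `H`. -/
theorem length_restrict (H : Set (V → ZMod 2)) (L : List (Set (V → ZMod 2))) :
    (restrict H L).length + (L.filter fun N => !neB (N ∩ H)).length = L.length := by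
  induction L with
  | nil => simp [restrict]
  | cons M L ih =>
    simp only [restrict, List.map_cons, List.filter_cons] at ih ⊢
    cases h : neB (M ∩ H) <;> simp <;> omega

omit [Fintype V] in
/-- Counting: `K` distinct lines satisfying `p` give `K ≤ |L.filter p|`. -/
theorem card_le_length_filter {L : List (Set (V → ZMod 2))} (p : Set (V → ZMod 2) → Bool)
    (s : Finset (Set (V → ZMod 2))) (hs : ∀ N ∈ s, N ∈ L ∧ p N = true) :
    s.card ≤ (L.filter p).length := by
  classical
  calc s.card ≤ (L.filter p).toFinset.card := by
        refine Finset.card_le_card fun N hN => ?_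
        rw [List.mem_toFinset, List.mem_filter]
        exact hs N hN
    _ ≤ (L.filter p).length := List.toFinset_card_le _

/-- RANK under restriction to a hyperplane section `H = A ∩ hyp η` of `A`: the rank relative to
`H` of `N ∩ H` is at most the rank of `N` relative to `A`. -/
theorem codim_restrict_le {A N : Set (V → ZMod 2)} (hN : IsFlat N) (hNA : N ⊆ A) (η : Eqn V)
    (hH : finrank (ZMod 2) ↥(W (A ∩ hyp η)) = finrank (ZMod 2) ↥(W A) + 1)
    (hne : (N ∩ (A ∩ hyp η)).Nonempty) : codim (A ∩ hyp η) (N ∩ (A ∩ hyp η)) ≤ codim A N := by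
  have hNeq : N ∩ (A ∩ hyp η) = N ∩ hyp η := by
    rw [← Set.inter_assoc, Set.inter_eq_left.2 hNA]
  rw [codim, codim, hNeq, hH]
  have h1 := finrank_W_inter_hyp_le hN η (by rwa [hNeq] at hne)
  have h2 : finrank (ZMod 2) ↥(W A) ≤ finrank (ZMod 2) ↥(W N) := Submodule.finrank_mono (W_anti hNA)
  omega

/-- WIDTH under restriction to a hyperplane section does not grow. -/
theorem width_restrict_le {𝒞 : Set (Set (V → ZMod 2))} {A : Set (V → ZMod 2)}
    {L : List (Set (V → ZMod 2))} (hL : IsRef 𝒞 A L) (η : Eqn V)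
    (hH : finrank (ZMod 2) ↥(W (A ∩ hyp η)) = finrank (ZMod 2) ↥(W A) + 1) :
    width (A ∩ hyp η) (restrict (A ∩ hyp η) L) ≤ width A L := by
  rw [width_le_iff]
  intro N hN hne
  obtain ⟨M, hM, rfl, -⟩ := mem_restrict_iff.1 hN
  have hMne : M.Nonempty := hne.mono Set.inter_subset_left
  exact (codim_restrict_le (hL.flat M hM) (hL.subset M hM) η hH hne).trans
    (codim_le_width hM hMne)

end Semantic

end ResLinSW

end Summit.PneNP.PneNP.Theorems
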